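import Literature.Computability.QuantumComplexity.EvenSVTDegreeBookkeeping
import Literature.Computability.QuantumComplexity.SketchedOversamplingAccess
import HarnessLib

/-!
# The output vector of even polynomial singular value transformation from `SQ_φ(A)`: error
# propagation to `q(AᵀA)b` and oversampling access `SQ_{φ_v}(v)` with its exact factor
# (CGLLTW 2022, §3.3 Theorem 3.4, even case — the vector step of the proof, via Lemma "sample-Mv")

Chia, Gilyén, Li, Lin, Tang, Wang, *Sampling-based sublinear low-rank matrix arithmetic framework
for dequantizing quantum machine learning*, J. ACM 69(5):33 (2022) = arXiv:1910.06151, §3.3,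
proof of Theorem 3.4, even case, after the matrix-level step (held arXiv text p. 21 L1–20):

> This reduces the problem to approximating `R†f̄(CC†)Rb + f(0)b`.  We further approximate
> `Rb ≈ u ∈ ℂ^r` such that `‖Rb − u‖ ≤ ε/d` … As a consequence, `v := R†f̄(CC†)u + f(0)b`
> satisfies `‖v − p^{(SV)}(A)b‖ ≲ ε`.  Via (lemma:sample-Mv), we can get `SQ_φ(v)` with
> `φ·s_φ(v) = ((r+1)(‖R‖_F²‖f̄(CC†)u‖² + p(0)²‖b‖²)/‖v‖²)·…`

This module types the two mathematical statements of that paragraph, for ANY sketch `R`, matrix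
`M` (the print's `f̄(CC†)`), vector `u` (the print's approximation of `Rb`), scalar `c` (the
print's `f(0) = q(0)`), vector `b` and target matrix `F` (e.g. `q(AᵀA)`, `= p^{(SV)}(A)` for
`p(x) = q(x²)`):

* `output_sub_eq`, **`output_error_le`** — the deterministic ERROR PROPAGATION
  `‖(RᵀMu + c·b) − Fb‖ ≤ ‖RᵀMR + cI − F‖_F·‖b‖ + ‖RᵀM‖_F·‖u − Rb‖` (Cauchy–Schwarz; the first
  term is the matrix-level event of `EvenPolySVT.even_polynomial_svt`, the second the budget of
  the approximation `u ≈ Rb`), and `output_error_le_exact` (`u = Rb`);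
* `outputTilde`, `sq_output_le_outputTilde_sq`, `normSq_outputTilde`, **`outputWitness`** — the
  OUTPUT ACCESS: `v = Rᵀw + c·b` (`w = Mu`) is a linear combination of the `s` rows of `R` and of
  `b` (`s + 1` terms), so entrywise DOMINATING DATA `R̃ ⊒ R`, `b̃ ⊒ b` give the dominating vector
  `ṽ(i) = √((s+1)(Σ_t w_t² R̃(t,i)² + c² b̃(i)²))` and, for `v ≠ 0`, the `OversamplingWitness`
  of `SQ_{φ_v}(v)` with the EXACT factor `φ_v = ‖ṽ‖²/‖v‖²`,
  `‖ṽ‖² = (s+1)(Σ_t w_t²‖R̃(t,·)‖² + c²‖b̃‖²)`.  This is Lemma "sample-Mv" (= Tang 2019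
  Prop. 4.3, the tree's `OversamplingWitness.linComb`) stated over dominating data, as the tree's
  `MatrixOversamplingWitness.rurWitness` does for `RᵀUR` — a sketched row `(S_ωA)(t,·)` may vanish
  while its dominating row `(S_ωÃ)(t,·)` does not, so per-term witnesses need not exist; at exact
  data (`R̃ = R`, `b̃` the witness of `SQ_{φ_b}(b)`) `ṽ` is LITERALLY `linCombTilde` of the `s + 1`
  witnesses `b̃, refl R(0,·), …` (`outputTilde_eq_linCombTilde`; cf. `LowRankPCA.outputWitness`,
  the case without the `b`-term);
* `normSq_outputTilde_sketch_le` — for the importance-sampling sketch `R = S_ωA` of `SQ_ϕ(A)` with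
  dominating rows `R̃ = S_ωÃ` (tree `sketch_sq_le_sketch_tilde_sq`, `normSq_sketch_mul_row_le`)
  and `SQ_{φ_b}(b)`: **`φ_v‖v‖² = ‖ṽ‖² ≤ (s+1)(ϕ‖A‖_F²‖w‖²/s + c²φ_b‖b‖²)`** for general `ϕ`,
  `φ_b` (print: `ϕ = φ_b = 1`, row sum bounded by `‖R‖_F²‖w‖²`);
* **`even_polynomial_svt_output`** — `EvenPolySVT.even_polynomial_svt` pushed to the vector `b` at
  `u = Rb`: under its hypotheses and thresholds, for every `b`, the two-stage mass of
  `‖(Rᵀq̄_clamp(CCᵀ)R + q(0)I)b − q(AᵀA)b‖ ≤ ε‖b‖` exceeds `1 − δ`.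

HONEST SCOPE.  Deterministic linear algebra plus the tree's sampling theorem, in the host's
Frobenius / Euclidean currency.  The print's SUBLINEAR approximation `u ≈ Rb` by inner-product
sampling (sample count `≍ ‖A‖_F²‖b‖²d²/(ε²δ)`) enters ONLY as the free term `‖RᵀM‖_F‖u − Rb‖` of
`output_error_le`: its sampling cost, and ALL query counts and running times, are NOT typed; the
bound `‖f̄(CC†)u‖ ≤ (max f̄)‖u‖` is left symbolic (`‖w‖`); the ODD case's output (`A·(…)b` via
three approximate matrix products) is NOT attempted; no algorithm, sampler, query cost or
data structure is modelled.  Nothing here bears on `BQP` vs `BPP`.  All statements are theorems or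
explicit witness data (`outputTilde`, `outputWitness`); no named facts; standard axioms.
-/

noncomputable section

open scoped Matrix
open Polynomial Finset

namespace Literature.Computability.QuantumComplexity.SampleQuery.EvenPolySVT.Output

variable {m n s c : ℕ}

/-! ### §1 Norm bookkeeping (`‖·‖ = √normSq`, `‖·‖_F = √frobSq`) -/

/-- `‖Xy‖² ≤ ‖X‖_F²‖y‖²` (Cauchy–Schwarz row by row). [folklore] -/
private theorem normSq_mulVec_le {k l : ℕ} (X : Matrix (Fin k) (Fin l) ℝ) (y : Fin l → ℝ) :
    normSq (X *ᵥ y) ≤ frobSq X * normSq y := by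
  unfold frobSq
  rw [Finset.sum_mul]
  refine Finset.sum_le_sum fun i _ => ?_
  have h : (X *ᵥ y) i = ∑ j, X i j * y j := rfl
  rw [h]
  exact Finset.sum_mul_sq_le_sq_mul_sq _ _ _

/-- `‖Xy‖ ≤ ‖X‖_F‖y‖`. [folklore] -/
private theorem sqrt_normSq_mulVec_le {k l : ℕ} (X : Matrix (Fin k) (Fin l) ℝ) (y : Fin l → ℝ) :
    Real.sqrt (normSq (X *ᵥ y)) ≤ Real.sqrt (frobSq X) * Real.sqrt (normSq y) := by
  rw [← Real.sqrt_mul (frobSq_nonneg X)]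
  exact Real.sqrt_le_sqrt (normSq_mulVec_le X y)

/-- Triangle inequality for `√normSq`. [folklore] -/
private theorem sqrt_normSq_add_le {l : ℕ} (u w : Fin l → ℝ) :
    Real.sqrt (normSq (u + w)) ≤ Real.sqrt (normSq u) + Real.sqrt (normSq w) := by
  have hu := Real.sqrt_nonneg (normSq u)
  have hw := Real.sqrt_nonneg (normSq w)
  rw [Real.sqrt_le_left (by positivity)]
  have hcs' := Real.sum_mul_le_sqrt_mul_sqrt Finset.univ (fun i => |u i|) (fun i => |w i|)
  have hcs : ∑ i, u i * w i ≤ Real.sqrt (normSq u) * Real.sqrt (normSq w) := by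
    refine (sum_le_sum fun i _ => (le_abs_self _).trans_eq (abs_mul (u i) (w i))).trans ?_
    simpa [normSq, sq_abs] using hcs'
  have hexp : normSq (u + w) = normSq u + 2 * ∑ i, u i * w i + normSq w := by
    simp only [normSq, Pi.add_apply, add_sq, sum_add_distrib, mul_sum]
    ring_nf
  rw [hexp, add_sq, Real.sq_sqrt (normSq_nonneg u), Real.sq_sqrt (normSq_nonneg w)]
  nlinarith

/-! ### §2 Error propagation to the vector (deterministic) -/

/-- **The algebra of the vector step.**  For any `R`, `M`, `u`, `c`, `b` and target matrix `F`:
`(RᵀMu + c·b) − Fb = (RᵀMR + cI − F)b + RᵀM(u − Rb)`.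
[cite: ChiaEtAl2022, §3.3 proof of Theorem 3.4 ("This reduces the problem to approximating
`R†f̄(CC†)Rb + f(0)b`. We further approximate `Rb ≈ u`", held arXiv text p. 21 L1–2)] -/
theorem output_sub_eq (R : Matrix (Fin s) (Fin n) ℝ) (M : Matrix (Fin s) (Fin s) ℝ)
    (F : Matrix (Fin n) (Fin n) ℝ) (u : Fin s → ℝ) (c : ℝ) (b : Fin n → ℝ) :
    Rᵀ *ᵥ (M *ᵥ u) + c • b - F *ᵥ b =
      (Rᵀ * M * R + c • (1 : Matrix (Fin n) (Fin n) ℝ) - F) *ᵥ b + (Rᵀ * M) *ᵥ (u - R *ᵥ b) := by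
  simp only [Matrix.sub_mulVec, Matrix.add_mulVec, Matrix.mulVec_sub, Matrix.smul_mulVec,
    Matrix.one_mulVec, ← Matrix.mulVec_mulVec]
  abel

/-- **Error propagation (the vector step of Theorem 3.4, deterministic form).**  For any `R`,
`M`, `u`, `c`, `b`, `F`:
`‖(RᵀMu + c·b) − Fb‖ ≤ ‖RᵀMR + cI − F‖_F·‖b‖ + ‖RᵀM‖_F·‖u − Rb‖`
(`‖·‖ = √normSq`, `‖·‖_F = √frobSq`; Cauchy–Schwarz).  The first term is the matrix-level event
(`F = q(AᵀA)`, `M = q̄_clamp(CCᵀ)`, `c = q(0)`), the second the budget of the approximation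
`u ≈ Rb` (the print's `‖Rb − u‖ ≤ ε/d`, whose sampling cost is not typed here).
[cite: ChiaEtAl2022, §3.3 proof of Theorem 3.4 ("This suffices to maintain the error bound …
`v := R†f̄(CC†)u + f(0)b` satisfies `‖v − p^{(SV)}(A)b‖ ≲ ε`", held arXiv text p. 21 L3–13)] -/
theorem output_error_le (R : Matrix (Fin s) (Fin n) ℝ) (M : Matrix (Fin s) (Fin s) ℝ)
    (F : Matrix (Fin n) (Fin n) ℝ) (u : Fin s → ℝ) (c : ℝ) (b : Fin n → ℝ) :
    Real.sqrt (normSq (Rᵀ *ᵥ (M *ᵥ u) + c • b - F *ᵥ b)) ≤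
      Real.sqrt (frobSq (Rᵀ * M * R + c • (1 : Matrix (Fin n) (Fin n) ℝ) - F)) *
          Real.sqrt (normSq b) +
        Real.sqrt (frobSq (Rᵀ * M)) * Real.sqrt (normSq (u - R *ᵥ b)) := by
  rw [output_sub_eq]
  exact (sqrt_normSq_add_le _ _).trans
    (add_le_add (sqrt_normSq_mulVec_le _ _) (sqrt_normSq_mulVec_le _ _))

/-- **Error propagation at `u = Rb` (no vector approximation):**
`‖(RᵀMR + cI)b − Fb‖ ≤ ‖RᵀMR + cI − F‖_F·‖b‖`. [cite: ChiaEtAl2022, §3.3 proof of Theorem 3.4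
(vector step, `u = Rb`)] -/
theorem output_error_le_exact (R : Matrix (Fin s) (Fin n) ℝ) (M : Matrix (Fin s) (Fin s) ℝ)
    (F : Matrix (Fin n) (Fin n) ℝ) (c : ℝ) (b : Fin n → ℝ) :
    Real.sqrt (normSq ((Rᵀ * M * R + c • (1 : Matrix (Fin n) (Fin n) ℝ)) *ᵥ b - F *ᵥ b)) ≤
      Real.sqrt (frobSq (Rᵀ * M * R + c • (1 : Matrix (Fin n) (Fin n) ℝ) - F)) *
        Real.sqrt (normSq b) := by
  rw [← Matrix.sub_mulVec]
  exact sqrt_normSq_mulVec_le _ _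

/-! ### §3 Oversampling access to the output (Lemma "sample-Mv" at `s + 1` terms) -/

/-- `(Rᵀw + c·b)(i) = Σ_t w_t R(t,i) + c·b(i)` — the output is a linear combination of the rows of
`R` and of `b`. [cite: ChiaEtAl2022, §3.3 proof of Theorem 3.4 ("Via (lemma:sample-Mv), we can
get `SQ_φ(v)`")] -/
theorem output_apply (R : Matrix (Fin s) (Fin n) ℝ) (w : Fin s → ℝ) (c : ℝ) (b : Fin n → ℝ)
    (i : Fin n) : (Rᵀ *ᵥ w + c • b) i = ∑ t, w t * R t i + c * b i := by
  simp [Matrix.mulVec_transpose, Matrix.vecMul, dotProduct]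

/-- **The dominating vector of the output** built from dominating data `R̃` (rows) and `b̃`:
`ṽ(i) = √((s+1)·(Σ_t w_t² R̃(t,i)² + c² b̃(i)²))` — the factor `s + 1` is the NUMBER OF TERMS of
the linear combination `Σ_t w_t R(t,·) + c·b` (Cauchy–Schwarz), as in the tree's `linCombTilde`
(`k` terms ↦ factor `k`), here written over dominating data `R̃`, `b̃`.
[cite: ChiaEtAl2022, §2.2 (Linear combinations) and §3.3 proof of Theorem 3.4 (sample-Mv);
TangEwin2019, Prop. 4.3] -/
def outputTilde (Rt : Matrix (Fin s) (Fin n) ℝ) (bt : Fin n → ℝ) (w : Fin s → ℝ) (c : ℝ)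
    (i : Fin n) : ℝ :=
  Real.sqrt ((s + 1) * (∑ t, w t ^ 2 * Rt t i ^ 2 + c ^ 2 * bt i ^ 2))

/-- `ṽ(i)² = (s+1)(Σ_t w_t² R̃(t,i)² + c² b̃(i)²)`. [cite: ChiaEtAl2022, §2.2 (Linear
combinations)] -/
theorem outputTilde_sq (Rt : Matrix (Fin s) (Fin n) ℝ) (bt : Fin n → ℝ) (w : Fin s → ℝ) (c : ℝ)
    (i : Fin n) :
    outputTilde Rt bt w c i ^ 2 = (s + 1) * (∑ t, w t ^ 2 * Rt t i ^ 2 + c ^ 2 * bt i ^ 2) :=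
  Real.sq_sqrt (mul_nonneg (by positivity) (add_nonneg
    (sum_nonneg fun _ _ => mul_nonneg (sq_nonneg _) (sq_nonneg _))
    (mul_nonneg (sq_nonneg _) (sq_nonneg _))))

/-- **`‖ṽ‖² = (s+1)(Σ_t w_t²‖R̃(t,·)‖² + c²‖b̃‖²)`** — the exact oversampling numerator.
[cite: ChiaEtAl2022, §2.2 (Linear combinations, `φ = τ Σ_t φ^{(t)}‖λ_t v^{(t)}‖²/‖v‖²`) and §3.3
proof of Theorem 3.4 (the display for `φ·s_φ(v)`)] -/
theorem normSq_outputTilde (Rt : Matrix (Fin s) (Fin n) ℝ) (bt : Fin n → ℝ) (w : Fin s → ℝ)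
    (c : ℝ) :
    normSq (outputTilde Rt bt w c) =
      (s + 1) * (∑ t, w t ^ 2 * normSq (Rt t) + c ^ 2 * normSq bt) := by
  unfold normSq
  simp_rw [outputTilde_sq, ← mul_sum, sum_add_distrib, ← mul_sum]
  congr 2
  rw [sum_comm]
  exact sum_congr rfl fun t _ => by rw [mul_sum]

/-- **Entrywise domination** (Cauchy–Schwarz over the `s + 1` terms): if `R(t,i)² ≤ R̃(t,i)²` and
`b(i)² ≤ b̃(i)²` then `(Rᵀw + c·b)(i)² ≤ ṽ(i)²`. [cite: ChiaEtAl2022, §2.2 (Linear combinations,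
proof via Cauchy–Schwarz); TangEwin2019, Prop. 4.3] -/
theorem sq_output_le_outputTilde_sq {R Rt : Matrix (Fin s) (Fin n) ℝ} {b bt : Fin n → ℝ}
    (hR : ∀ t i, R t i ^ 2 ≤ Rt t i ^ 2) (hb : ∀ i, b i ^ 2 ≤ bt i ^ 2) (w : Fin s → ℝ) (c : ℝ)
    (i : Fin n) : (Rᵀ *ᵥ w + c • b) i ^ 2 ≤ outputTilde Rt bt w c i ^ 2 := by
  rw [output_apply, outputTilde_sq]
  -- the `s + 1` summands, as a family over `Fin (s + 1)`
  set a : Fin (s + 1) → ℝ := Fin.cons (c * b i) (fun t => w t * R t i) with ha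
  have hsum : ∑ t, w t * R t i + c * b i = ∑ j, a j := by
    rw [Fin.sum_univ_succ, ha]
    simp only [Fin.cons_zero, Fin.cons_succ]
    ring
  have hsq : ∑ j, a j ^ 2 = c ^ 2 * b i ^ 2 + ∑ t, w t ^ 2 * R t i ^ 2 := by
    rw [Fin.sum_univ_succ, ha]
    simp only [Fin.cons_zero, Fin.cons_succ, mul_pow]
  have hcs : (∑ j, a j) ^ 2 ≤ (s + 1) * ∑ j, a j ^ 2 := by
    have h := sq_sum_le_card_mul_sum_sq (s := (univ : Finset (Fin (s + 1)))) (f := a)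
    simpa using h
  rw [hsum]
  refine hcs.trans ?_
  rw [hsq]
  have hs1 : (0 : ℝ) ≤ s + 1 := by positivity
  refine mul_le_mul_of_nonneg_left ?_ hs1
  rw [add_comm]
  exact add_le_add (sum_le_sum fun t _ => mul_le_mul_of_nonneg_left (hR t i) (sq_nonneg _))
    (mul_le_mul_of_nonneg_left (hb i) (sq_nonneg _))

/-- **`SQ_{φ_v}(v)` for the output `v = Rᵀw + c·b` (Lemma "sample-Mv" at `s + 1` terms).**
Given entrywise dominating data `R̃ ⊒ R` (rows one can length-square sample, e.g. `R̃ = R` for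
exact access, or the sketched rows `S_ωÃ` of `SQ_ϕ(A)` — tree `sketch_sq_le_sketch_tilde_sq`) and
`b̃ ⊒ b` (e.g. the witness of `SQ_{φ_b}(b)`), the vector `ṽ = outputTilde R̃ b̃ w c` is an oversampling witness for `v ≠ 0` with
the EXACT factor `φ_v = ‖ṽ‖²/‖v‖²`, `‖ṽ‖² = (s+1)(Σ_t w_t²‖R̃(t,·)‖² + c²‖b̃‖²)`
(`normSq_outputTilde`).  Sampling from `𝒟_ṽ` is the two-stage mixture of the tree's
`OversamplingWitness.mixture_eq_lengthSqDist_linCombTilde` (pick a term `∝` its weight, then an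
index from that term); query access to `v(i)` costs `s + 1` queries.  The hypothesis `v ≠ 0` is
the print's implicit `‖v‖ ≠ 0` in the denominator. [cite: ChiaEtAl2022, §3.3 proof of Theorem 3.4
("Via (lemma:sample-Mv), we can get `SQ_φ(v)` with `φ·s_φ(v) = ((r+1)(‖R‖_F²‖f̄(CC†)u‖² +
p(0)²‖b‖²)/‖v‖²)…`", held arXiv text p. 21 L14–20); TangEwin2019, Prop. 4.3] -/
def outputWitness {R Rt : Matrix (Fin s) (Fin n) ℝ} {b bt : Fin n → ℝ}
    (hR : ∀ t i, R t i ^ 2 ≤ Rt t i ^ 2) (hb : ∀ i, b i ^ 2 ≤ bt i ^ 2) (w : Fin s → ℝ) (c : ℝ)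
    (hne : Rᵀ *ᵥ w + c • b ≠ 0) :
    OversamplingWitness (normSq (outputTilde Rt bt w c) / normSq (Rᵀ *ᵥ w + c • b))
      (Rᵀ *ᵥ w + c • b) where
  tilde := outputTilde Rt bt w c
  normSq_tilde := by rw [div_mul_cancel₀ _ (normSq_pos hne).ne']
  sq_le i := sq_output_le_outputTilde_sq hR hb w c i

/-- **Exact-access instance** (`R̃ = R`, `SQ_{φ_b}(b)` with witness `b̃`): the factor's numerator is
`‖ṽ‖² = (s+1)(Σ_t w_t²‖R(t,·)‖² + c²φ_b‖b‖²)`; bounding `Σ_t w_t²‖R(t,·)‖² ≤ ‖w‖²·‖R‖_F²` gives the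
printed display `(r+1)(‖R‖_F²‖f̄(CC†)u‖² + p(0)²‖b‖²)` (`φ_b = 1` there). [cite: ChiaEtAl2022,
§3.3 proof of Theorem 3.4 (display for `φ·s_φ(v)`, held arXiv text p. 21 L16–17)] -/
theorem normSq_outputTilde_exact {φb : ℝ} (R : Matrix (Fin s) (Fin n) ℝ) {b : Fin n → ℝ}
    (wb : OversamplingWitness φb b) (w : Fin s → ℝ) (c : ℝ) :
    normSq (outputTilde R wb.tilde w c) =
      (s + 1) * (∑ t, w t ^ 2 * normSq (R t) + c ^ 2 * (φb * normSq b)) := by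
  rw [normSq_outputTilde, wb.normSq_tilde]

/-- **At exact data the dominating vector IS the tree's `linCombTilde`** of the `s + 1` witnesses
`b̃` (of `SQ_{φ_b}(b)`), `refl R(0,·), …, refl R(s−1,·)` with coefficients `c, w_0, …, w_{s−1}` —
i.e. `outputWitness` is `OversamplingWitness.linComb` (Lemma "sample-Mv") written over dominating
data. [cite: ChiaEtAl2022, §2.2 (Linear combinations); TangEwin2019, Prop. 4.3] -/
theorem outputTilde_eq_linCombTilde {φb : ℝ} (R : Matrix (Fin s) (Fin n) ℝ) {b : Fin n → ℝ}
    (wb : OversamplingWitness φb b) (w : Fin s → ℝ) (c : ℝ) :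
    outputTilde R wb.tilde w c =
      OversamplingWitness.linCombTilde (φs := Fin.cons φb (fun _ : Fin s => (1 : ℝ)))
        (vs := Fin.cons b (fun t => R t))
        (Fin.cons wb (fun t => OversamplingWitness.refl (R t))) (Fin.cons c w) := by
  funext i
  unfold outputTilde OversamplingWitness.linCombTilde
  congr 1
  rw [Fin.sum_univ_succ]
  simp only [Fin.cons_zero, Fin.cons_succ, OversamplingWitness.refl_tilde]
  push_cast
  ring

/-- **Sketched instance (the setting of Theorem 3.4).**  For `SQ_ϕ(A)` (`A ≠ 0`), the
importance-sampling sketch `R = S_ωA` along any sample sequence `ω`, its dominating rows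
`R̃ = S_ωÃ` (tree: `sketch_sq_le_sketch_tilde_sq`; each of squared norm `≤ ϕ‖A‖_F²/s`,
`normSq_sketch_mul_row_le`) and `SQ_{φ_b}(b)`:
**`‖ṽ‖² ≤ (s+1)·(ϕ‖A‖_F²·‖w‖²/s + c²φ_b‖b‖²)`**, i.e. the output `v = Rᵀw + c·b`
(`w = q̄_clamp(CCᵀ)u`, `c = q(0)`) has, when `v ≠ 0`, `SQ_{φ_v}(v)` with `φ_v‖v‖² = ‖ṽ‖²` at most
this, for general `ϕ`, `φ_b` and every `s` (at `s = 0` both sides read `c²φ_b‖b‖²`, Lean's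
`x/0 = 0` being harmless there).  The print bounds the row sum by `‖R‖_F²‖w‖²` (`≈ ‖A‖_F²‖w‖²`);
the equal row norms of the importance-sampling sketch of `Ã` give the extra `1/s` here. [cite: ChiaEtAl2022, §3.3 proof of
Theorem 3.4 (display for `φ·s_φ(v)`, held arXiv text p. 21 L14–20; "using that
`‖R‖_F ≲ ‖A‖_F`")] -/
theorem normSq_outputTilde_sketch_le {ϕ φb : ℝ} {A : Matrix (Fin m) (Fin n) ℝ}
    (W : MatrixOversamplingWitness ϕ A) (hA : A ≠ 0) (ω : Fin s → Fin m) {b : Fin n → ℝ}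
    (wb : OversamplingWitness φb b) (w : Fin s → ℝ) (c : ℝ) :
    normSq (outputTilde (sketch (rowDist W.tilde) ω * W.tilde) wb.tilde w c) ≤
      (s + 1) * (ϕ * frobSq A * normSq w / s + c ^ 2 * (φb * normSq b)) := by
  rw [normSq_outputTilde, wb.normSq_tilde]
  have hs1 : (0 : ℝ) ≤ s + 1 := by positivity
  refine mul_le_mul_of_nonneg_left (add_le_add ?_ le_rfl) hs1
  have h1 : IsOversampledDist 1 (rowNorms W.tilde) (rowDist W.tilde) := by
    simpa using (MatrixOversamplingWitness.refl W.tilde).isOversampledDist_rowDist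
      (W.tilde_ne_zero hA)
  have hrow : ∀ t, normSq ((sketch (rowDist W.tilde) ω * W.tilde) t) ≤ ϕ * frobSq A / s := by
    intro t
    have h := normSq_sketch_mul_row_le h1 one_pos ω t
    rw [W.frobSq_tilde] at h
    calc _ ≤ 1 / s * (ϕ * frobSq A) := h
      _ = ϕ * frobSq A / s := by ring
  calc ∑ t, w t ^ 2 * normSq ((sketch (rowDist W.tilde) ω * W.tilde) t)
      ≤ ∑ t, w t ^ 2 * (ϕ * frobSq A / s) :=
        sum_le_sum fun t _ => mul_le_mul_of_nonneg_left (hrow t) (sq_nonneg _)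
    _ = ϕ * frobSq A * normSq w / s := by rw [← sum_mul]; unfold normSq; ring

/-! ### §4 The matrix-level theorem pushed to the vector `b` (`u = Rb`) -/

/-- **Two-stage mass is monotone in the event** (nonnegative weights). [folklore] -/
private theorem mass_mono {ι κ : Type*} [Fintype ι] (v : Finset κ) (wt : ι → ℝ)
    (wt' : ι → κ → ℝ) (hw : ∀ i, 0 ≤ wt i) (hw' : ∀ i j, 0 ≤ wt' i j) (P Q : ι → κ → Prop)
    [∀ i, DecidablePred (P i)] [∀ i, DecidablePred (Q i)] (hPQ : ∀ i j, P i j → Q i j) :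
    ∑ i, wt i * ∑ j ∈ v.filter (P i), wt' i j ≤ ∑ i, wt i * ∑ j ∈ v.filter (Q i), wt' i j := by
  refine Finset.sum_le_sum fun i _ => mul_le_mul_of_nonneg_left ?_ (hw i)
  refine Finset.sum_le_sum_of_subset_of_nonneg (fun j hj => ?_) (fun j _ _ => hw' i j)
  rw [Finset.mem_filter] at hj ⊢
  exact ⟨hj.1, hPQ i j hj.2⟩

variable {φ : ℝ} {A : Matrix (Fin m) (Fin n) ℝ}

/-- **Even polynomial SVT applied to a vector (CGLLTW Thm 3.4, even case, `u = Rb`).**  Under the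
hypotheses and thresholds of `EvenPolySVT.even_polynomial_svt` (`SQ_φ(A)`, `A ≠ 0`,
`spec(AᵀA) ⊆ [0,1]`, `deg q ≤ k`, `|q| ≤ 1` on `[0,1]`, `δ ∈ (0,1]`, `ε > 0`,
`s ≥ 8φ²(2k)⁴‖A‖_F⁴log(6/δ)/ε²`, `s ≥ 2φ²log(3/δ)`, `c ≥ 8φ⁶(2k)⁸‖A‖_F⁸log(6/δ)/ε²`), for EVERY
`b`, the two-stage mass of `‖(Rᵀq̄_clamp(CCᵀ)R + q(0)I)b − q(AᵀA)b‖ ≤ ε‖b‖` exceeds `1 − δ`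
(`q(AᵀA)b = p^{(SV)}(A)b` for `p(x) = q(x²)`).  The print's further sublinear approximation
`u ≈ Rb` is `output_error_le`'s second term and is not costed here.
[cite: ChiaEtAl2022, §3.3 Theorem 3.4 (even case: "`v` satisfies `‖v − p^{(SV)}(A)b‖ ≤ ε`",
held arXiv text p. 21 L13)] -/
theorem even_polynomial_svt_output (W : MatrixOversamplingWitness φ A) (hA : A ≠ 0)
    (hA1 : ∀ x ∈ spectrum ℝ (Aᵀ * A), x ≤ 1) (hs : 0 < s) (hc : 0 < c) {δ ε : ℝ}
    (hδ : 0 < δ) (hδ1 : δ ≤ 1) (hε : 0 < ε) {k : ℕ} (q : ℝ[X]) (hq : q.natDegree ≤ k)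
    (hq1 : ∀ y ∈ Set.Icc (0 : ℝ) 1, |q.eval y| ≤ 1)
    (hsL : 8 * φ ^ 2 * (2 * k) ^ 4 * frobSq A ^ 2 * Real.log (6 / δ) / ε ^ 2 ≤ s)
    (hs3 : 2 * φ ^ 2 * Real.log (3 / δ) ≤ s)
    (hcL : 8 * φ ^ 6 * (2 * k) ^ 8 * frobSq A ^ 4 * Real.log (6 / δ) / ε ^ 2 ≤ c)
    (b : Fin n → ℝ) :
    1 - δ <
      ∑ ω : Fin s → Fin m, iidWeight (rowDist W.tilde) ω *
        ∑ τ ∈ univ.filter (fun τ : Fin c → Fin n =>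
          Real.sqrt (normSq (((sketch (rowDist W.tilde) ω * A)ᵀ *
              cfc (qbarClamp q) ((sketch (rowDist (sketch (rowDist W.tilde) ω * W.tilde)ᵀ) τ *
                  (sketch (rowDist W.tilde) ω * A)ᵀ)ᵀ *
                (sketch (rowDist (sketch (rowDist W.tilde) ω * W.tilde)ᵀ) τ *
                  (sketch (rowDist W.tilde) ω * A)ᵀ)) *
              (sketch (rowDist W.tilde) ω * A) + (q.eval 0) • (1 : Matrix (Fin n) (Fin n) ℝ)) *ᵥ b -
              (aeval (Aᵀ * A) q) *ᵥ b)) ≤ ε * Real.sqrt (normSq b)),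
          iidWeight (rowDist (sketch (rowDist W.tilde) ω * W.tilde)ᵀ) τ := by
  classical
  refine lt_of_lt_of_le (even_polynomial_svt W hA hA1 hs hc hδ hδ1 hε q hq hq1 hsL hs3 hcL)
    (mass_mono _ _ _ (iidWeight_nonneg (W.isOversampledDist_rowDist hA).nonneg)
      (fun ω τ => iidWeight_nonneg (fun _ => div_nonneg (normSq_nonneg _) (frobSq_nonneg _)) τ)
      _ _ fun ω τ h => ?_)
  exact (output_error_le_exact _ _ _ _ _).trans
    (mul_le_mul_of_nonneg_right h (Real.sqrt_nonneg _))

end Literature.Computability.QuantumComplexity.SampleQuery.EvenPolySVT.Output
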